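import Literature.Geometry.Lorentzian.GeodesicProofs
import HarnessLib

/-!
# Additivity of the covariant derivative along a curve (discharge of `covariantDerivAlong_add`)

This file discharges the named fact `Literature.Geometry.Lorentzian.covariantDerivAlong_add` of
`Literature.Geometry.Lorentzian.Geodesic`: for a covariant derivative `cov` on the tangent bundle
of a real manifold `M` (finite-dimensional model space `E`), a curve `γ : ℝ → M` and two vector
fields `W₁, W₂` along `γ` whose lifts `t ↦ (γ t, Wᵢ t) ∈ TM` are differentiable at `t₀`,
`D(W₁ + W₂)/dt (t₀) = DW₁/dt (t₀) + DW₂/dt (t₀)` — O'Neill, *Semi-Riemannian geometry* (1983),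
Ch. 3, Prop. 18 (1), p. 65: the induced covariant derivative `Z ↦ Z' = DZ/dt` on `𝔛(α)` satisfies
`(a Z₁ + b Z₂)' = a Z₁' + b Z₂'`.

## The printed proof and its formalisation

O'Neill defines `Z'` on a coordinate neighbourhood by the formula
`Z' = ∑ (dZⁱ/dt) ∂ᵢ + ∑ Zⁱ D_{α'}(∂ᵢ)` (proof of Prop. 18, p. 66) and remarks that "straightforward
computations show that all four properties hold". In `Geodesic.lean` the covariant derivative
along `γ` *is* this frame formula, `covariantDerivAlongFrame cov e b γ W t₀ =
∑ᵢ (cⁱ)'(t₀) sᵢ(γ t₀) + ∑ᵢ cⁱ(t₀) ∇_{γ'(t₀)} sᵢ` in the local frame `sᵢ = e.localFrame b i` of an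
atlas trivialisation `e` of `TM` and a basis `b` of `E`, with coefficient functions
`cⁱ(t) = e.localFrame_coeff I b i (γ t) (W t)`; `covariantDerivAlong` is the canonical frame at
`γ t₀`. The straightforward computation for property (1) is: the coefficients are fibrewise linear,
`cⁱ(W₁ + W₂) = cⁱ(W₁) + cⁱ(W₂)`, and the one-variable derivative is additive on *differentiable*
functions. The only analytic input is therefore

* `differentiableAt_localFrame_coeff_along` — if the lift `t ↦ (γ t, W t)` is differentiable at
  `t₀` and `γ t₀ ∈ e.baseSet`, each coefficient function `cⁱ` is differentiable at `t₀` (read `W`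
  in the trivialisation `e`, `differentiableAt_trivialization_lift` of `GeodesicProofs.lean`, and
  apply the coordinate functional `b.coord i`); this is the smoothness of the component functions
  `Zⁱ = Z xⁱ` of a smooth `Z ∈ 𝔛(α)` used throughout O'Neill's proof, and the along-curve analogue
  of Mathlib's `mdifferentiableAt_localFrame_coeff`;

from which `covariantDerivAlongFrame_add` (additivity of the frame formula in every atlas frame
containing `γ t₀`) and the discharge `covariantDerivAlong_add_holds` follow by `map_add`,
`deriv_add` and reindexing the finite sums. (Without the differentiability hypotheses the
statement would be false for the junk value `deriv = 0`: take `c¹(W₁) = |t|`, `c¹(W₂) = -|t| + t`.)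

## References

* B. O'Neill, *Semi-Riemannian geometry with applications to relativity*, Academic Press 1983,
  Ch. 3, Prop. 18 (1), p. 65 (linearity of the induced covariant derivative), proof p. 66
  (coordinate formula) (key `ONeill1983`).
-/

noncomputable section

open Bundle Set Filter
open scoped Manifold ContDiff Topology

namespace Literature.Geometry.Lorentzian

variable {E : Type*} [NormedAddCommGroup E] [NormedSpace ℝ E] {H : Type*} [TopologicalSpace H]
  {I : ModelWithCorners ℝ E H} {M : Type*} [TopologicalSpace M] [ChartedSpace H M]
  [IsManifold I ∞ M]

/-! ### Coefficient functions of a vector field along a curve -/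

/-- **Coefficient functions along a differentiable lift are differentiable.** If the lift
`t ↦ (γ t, W t)` of a vector field `W` along `γ` is differentiable at `t₀` (as a curve in `TM`)
and `γ t₀` lies in the base set of an atlas trivialisation `e`, then every coefficient function
`t ↦ cⁱ(t) = e.localFrame_coeff I b i (γ t) (W t)` of `W` in the local frame induced by `e` and a
basis `b` of `E` is differentiable at `t₀`: read `W` in the trivialisation `e`, where it becomes a
differentiable curve in `E` (`differentiableAt_trivialization_lift`), and apply the coordinate
functional `b.coord i`; near `t₀` the curve stays in `e.baseSet`, where the coefficient is computed
through `e` (`Trivialization.localFrame_coeff_eq_coeff`). The along-curve analogue of Mathlib's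
`mdifferentiableAt_localFrame_coeff`; it is the smoothness of the component functions
`Zⁱ = Z xⁱ : I → ℝ` in O'Neill 1983, Ch. 3, proof of Prop. 18, p. 66. [cite: ONeill1983, Ch. 3, proof of Prop. 3.18] -/
theorem differentiableAt_localFrame_coeff_along {ι : Type*} [Finite ι]
    (e : Trivialization E (TotalSpace.proj : TangentBundle I M → M)) [MemTrivializationAtlas e]
    (b : Module.Basis ι ℝ E) {γ : ℝ → M} {W : Π t : ℝ, TangentSpace I (γ t)} {t₀ : ℝ}
    (he : γ t₀ ∈ e.baseSet)
    (hW : MDifferentiableAt 𝓘(ℝ, ℝ) I.tangent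
      (fun t ↦ (TotalSpace.mk' E (γ t) (W t) : TangentBundle I M)) t₀) (i : ι) :
    DifferentiableAt ℝ (fun t ↦ e.localFrame_coeff I b i (γ t) (W t)) t₀ := by
  haveI : FiniteDimensional ℝ E := b.finiteDimensional_of_finite
  -- `W` read in `e` is a differentiable curve in `E`, hence so is its `i`-th `b`-coordinate
  have h₁ := differentiableAt_trivialization_lift e hW he
  have h₂ : DifferentiableAt ℝ
      (fun t ↦ b.coord i ((e (TotalSpace.mk' E (γ t) (W t))).2)) t₀ :=
    (LinearMap.toContinuousLinearMap (b.coord i)).differentiableAt.comp t₀ h₁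
  -- near `t₀` the curve stays in `e.baseSet`, where the coefficient is computed through `e`
  have hγ : MDifferentiableAt 𝓘(ℝ, ℝ) I γ t₀ := mdifferentiableAt_of_mdifferentiableAt_lift hW
  refine h₂.congr_of_eventuallyEq ?_
  filter_upwards [hγ.continuousAt.preimage_mem_nhds (e.open_baseSet.mem_nhds he)] with t ht
  rw [e.localFrame_coeff_eq_coeff (I := I) (b := b) (s := fun _ ↦ W t) ht]
  simp

/-! ### Additivity of `DW/dt` -/

section Add

variable [FiniteDimensional ℝ E] (cov : CovariantDerivative I E (TangentSpace I : M → Type _))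

omit [FiniteDimensional ℝ E] in
/-- **Additivity of the frame formula for `DW/dt`.** In every atlas trivialisation `e ∋ γ t₀` and
basis `b` of `E`, `covariantDerivAlongFrame cov e b γ (W₁ + W₂) t₀ =
covariantDerivAlongFrame cov e b γ W₁ t₀ + covariantDerivAlongFrame cov e b γ W₂ t₀` whenever the
lifts of `W₁` and `W₂` to `TM` are differentiable at `t₀`: the coefficients `cⁱ` are fibrewise
linear and `(c₁ⁱ + c₂ⁱ)' = (c₁ⁱ)' + (c₂ⁱ)'` for coefficient functions differentiable at `t₀`
(`differentiableAt_localFrame_coeff_along`). O'Neill 1983, Ch. 3, Prop. 18 (1), p. 65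
("straightforward computations" in the existence part of the proof, p. 66). [cite: ONeill1983, Ch. 3, Prop. 3.18 (1)] -/
theorem covariantDerivAlongFrame_add {ι : Type*} [Fintype ι]
    (e : Trivialization E (TotalSpace.proj : TangentBundle I M → M)) [MemTrivializationAtlas e]
    (b : Module.Basis ι ℝ E) {γ : ℝ → M} {W₁ W₂ : Π t : ℝ, TangentSpace I (γ t)} {t₀ : ℝ}
    (he : γ t₀ ∈ e.baseSet)
    (hW₁ : MDifferentiableAt 𝓘(ℝ, ℝ) I.tangent
      (fun t ↦ (TotalSpace.mk' E (γ t) (W₁ t) : TangentBundle I M)) t₀)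
    (hW₂ : MDifferentiableAt 𝓘(ℝ, ℝ) I.tangent
      (fun t ↦ (TotalSpace.mk' E (γ t) (W₂ t) : TangentBundle I M)) t₀) :
    covariantDerivAlongFrame cov e b γ (fun t ↦ W₁ t + W₂ t) t₀ =
      covariantDerivAlongFrame cov e b γ W₁ t₀ + covariantDerivAlongFrame cov e b γ W₂ t₀ := by
  have hd : ∀ i, deriv (fun t ↦ e.localFrame_coeff I b i (γ t) (W₁ t) +
      e.localFrame_coeff I b i (γ t) (W₂ t)) t₀ =
        deriv (fun t ↦ e.localFrame_coeff I b i (γ t) (W₁ t)) t₀ +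
          deriv (fun t ↦ e.localFrame_coeff I b i (γ t) (W₂ t)) t₀ :=
    fun i ↦ deriv_add (differentiableAt_localFrame_coeff_along e b he hW₁ i)
      (differentiableAt_localFrame_coeff_along e b he hW₂ i)
  simp only [covariantDerivAlongFrame, map_add, hd, add_smul, Finset.sum_add_distrib]
  abel

/-- **Additivity of the covariant derivative along a curve** (discharge of the named fact
`covariantDerivAlong_add`): `D(W₁ + W₂)/dt (t₀) = DW₁/dt (t₀) + DW₂/dt (t₀)` for vector fields
`W₁, W₂` along `γ` with differentiable lifts at `t₀` — `covariantDerivAlongFrame_add` in the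
canonical frame at `γ t₀`, whose base set contains `γ t₀`. O'Neill 1983, Ch. 3, Prop. 18 (1),
p. 65: `(a Z₁ + b Z₂)' = a Z₁' + b Z₂'`. [cite: ONeill1983, Ch. 3, Prop. 3.18 (1)] -/
theorem covariantDerivAlong_add_holds : covariantDerivAlong_add (I := I) (M := M) cov := by
  intro γ W₁ W₂ t₀ hW₁ hW₂
  simp only [covariantDerivAlong_def]
  exact covariantDerivAlongFrame_add cov (trivializationAt E (TangentSpace I : M → Type _) (γ t₀))
    (Module.finBasis ℝ E) (FiberBundle.mem_baseSet_trivializationAt' (γ t₀)) hW₁ hW₂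

end Add

end Literature.Geometry.Lorentzian
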